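import Summits.AtomisticToContinuum.HydrodynamicLimit.Theses.ExpTailStaging
import HarnessLib

/-!
# `ExpTailStaging.ExpRateGivesCubicUI` (stmt-AtomisticToContinuum-11520): the tail-lattice glue, proved

`ExpVelocityMomentBound → EnergyCurrentTails` (route ExpTailStaging; K1 = stmt-11518 dominates the shared cubic
crux stmt-9235): apply K1 with horizon `t + 1`, then pointwise
`|v|³ 𝟙{|v| > M} ≤ δ e^{κ|v|}` for `M ≥ max 1 (24/(δκ⁴))` (from `x⁴/4! ≤ eˣ`), then monotonicity and linearity of
the lower Lebesgue integral — no measurability needed; the Euler solution and the `t = 0` LLN are not used.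
Ported from the crux workfile `Cruxes/ExpVelocityMomentBound/StrategistR1.lean` (crux-strategist r1, 2026-08-17).
References: B. Nachtergaele, H.-T. Yau, Comm. Math. Phys. 243 (2003) §3.2 (Chebyshev use of II.1);
R. Alonso, J. A. Cañizo, I. Gamba, C. Mouhot, Comm. PDE 38 (2013) (exponential moments of order one).
-/

noncomputable section

namespace Summit.AtomisticToContinuum.HydrodynamicLimit.Theorems

open MeasureTheory Set Filter
open scoped ENNReal BigOperators
open Literature.MathematicalPhysics.KineticTheory Literature.Analysis.FluidPDE
open Summit.AtomisticToContinuum.HydrodynamicLimit.Theses.ExpTailStaging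

/-! ## The dominance chain `K1 ⇒ EnergyCurrentTails (9235)` -/

/-- Exponential domination of the cubic tail: for `κ, δ > 0` and `r > max 1 (24/(δκ⁴))`, `r³ ≤ δ exp(κ r)`
(from `x⁴/24 ≤ eˣ` at `x = κ r`). -/
theorem cube_le_mul_exp_of_lt_expTail {κ δ r : ℝ} (hκ : 0 < κ) (hδ : 0 < δ)
    (hr : max 1 (24 / (δ * κ ^ 4)) < r) : r ^ 3 ≤ δ * Real.exp (κ * r) := by
  have h1 : 1 < r := lt_of_le_of_lt (le_max_left _ _) hr
  have h2 : 24 / (δ * κ ^ 4) < r := lt_of_le_of_lt (le_max_right _ _) hr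
  have hdc : 0 < δ * κ ^ 4 := by positivity
  have hkey : 24 < δ * κ ^ 4 * r := by
    rw [div_lt_iff₀ hdc] at h2
    linarith
  have hr0 : 0 < r := by linarith
  have hexp : (κ * r) ^ 4 / 24 ≤ Real.exp (κ * r) := by
    have h := Real.pow_div_factorial_le_exp (x := κ * r) (by positivity) 4
    simpa [Nat.factorial] using h
  calc r ^ 3 = 1 * r ^ 3 := (one_mul _).symm
    _ ≤ (δ * κ ^ 4 * r / 24) * r ^ 3 := by gcongr; linarith
    _ = δ * ((κ * r) ^ 4 / 24) := by ring
    _ ≤ δ * Real.exp (κ * r) := by gcongr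

/-- Indicator form: the cubic tail at the exponential cut-off is below `δ e^{κ|v|}` everywhere. -/
theorem indicator_cube_le_mul_exp_expTail {κ δ : ℝ} (hκ : 0 < κ) (hδ : 0 < δ) (v : V3) :
    Set.indicator {w : V3 | max 1 (24 / (δ * κ ^ 4)) < ‖w‖} (fun w => ‖w‖ ^ 3) v ≤
      δ * Real.exp (κ * ‖v‖) := by
  by_cases hv : max 1 (24 / (δ * κ ^ 4)) < ‖v‖
  · rw [Set.indicator_of_mem (show v ∈ {w : V3 | max 1 (24 / (δ * κ ^ 4)) < ‖w‖} from hv)]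
    exact cube_le_mul_exp_of_lt_expTail hκ hδ hv
  · rw [Set.indicator_of_notMem (show v ∉ {w : V3 | max 1 (24 / (δ * κ ^ 4)) < ‖w‖} from hv)]
    positivity

/-- **K1 ⇒ `EnergyCurrentTails`** (the route's decl of the shared cubic item stmt-9235).  At `(t, ε)` apply K1
with horizon `t + 1` to get `κ, C, N₀`; put `δ = ε/(max C 0 + 1)` and `M = max 1 (24/(δκ⁴))`; pointwise
`|v|³𝟙{|v| > M} ≤ δe^{κ|v|}`, so the lower integral is at most `δ · C ≤ ε` for `N ≥ N₀`, `s ∈ [0, t] ⊆ [0, t+1]`.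
The Euler solution and the `t = 0` law of large numbers in the hypotheses of the item are not used. -/
theorem energyCurrentTails_of_expVelocityMomentBound (h : ExpVelocityMomentBound) : EnergyCurrentTails := by
  intro a₀ θ₀ u₀ ha hθ hu ha0 hθ0
  obtain ⟨σ₀, hσ₀, hσ⟩ := h a₀ θ₀ u₀ ha hθ hu ha0 hθ0
  refine ⟨σ₀, hσ₀, fun σ hσp hσl T ρ θ u _hE Φ _hLLN t ht ε hε => ?_⟩
  obtain ⟨κ, hκ, C, N₀, hb⟩ := hσ σ hσp hσl (t + 1) (by linarith [ht.1]) Φ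
  set δ : ℝ := ε / (max C 0 + 1) with hδ
  have hC1 : 0 < max C 0 + 1 := by positivity
  have hδpos : 0 < δ := div_pos hε hC1
  have hδC : δ * C ≤ ε := by
    calc δ * C ≤ δ * (max C 0 + 1) := by
          refine mul_le_mul_of_nonneg_left ?_ hδpos.le
          linarith [le_max_left C 0]
      _ = ε := by rw [hδ, div_mul_cancel₀ _ hC1.ne']
  refine ⟨max 1 (24 / (δ * κ ^ 4)), N₀, fun N hN s hs => ?_⟩
  have hsT : s ∈ Set.Icc 0 (t + 1) := ⟨hs.1, hs.2.trans (by linarith)⟩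
  have hpt : ∀ z : Config (N + 1) (Fin 3) T3,
      ENNReal.ofReal (((N : ℝ) + 1)⁻¹ * ∑ i : Fin (N + 1),
        Set.indicator {v : V3 | max 1 (24 / (δ * κ ^ 4)) < ‖v‖} (fun v => ‖v‖ ^ 3)
          (((Φ N).flow s z i).2)) ≤
      ENNReal.ofReal δ * ENNReal.ofReal (((N : ℝ) + 1)⁻¹ * ∑ i : Fin (N + 1),
        Real.exp (κ * ‖((Φ N).flow s z i).2‖)) := by
    intro z
    rw [← ENNReal.ofReal_mul hδpos.le]
    refine ENNReal.ofReal_le_ofReal ?_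
    calc ((N : ℝ) + 1)⁻¹ * ∑ i : Fin (N + 1),
          Set.indicator {v : V3 | max 1 (24 / (δ * κ ^ 4)) < ‖v‖} (fun v => ‖v‖ ^ 3)
            (((Φ N).flow s z i).2)
        ≤ ((N : ℝ) + 1)⁻¹ * ∑ i : Fin (N + 1), δ * Real.exp (κ * ‖((Φ N).flow s z i).2‖) :=
          mul_le_mul_of_nonneg_left
            (Finset.sum_le_sum fun i _ => indicator_cube_le_mul_exp_expTail hκ hδpos _) (by positivity)
      _ = δ * (((N : ℝ) + 1)⁻¹ * ∑ i : Fin (N + 1), Real.exp (κ * ‖((Φ N).flow s z i).2‖)) := by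
          rw [← Finset.mul_sum]
          ring
  calc ∫⁻ z, ENNReal.ofReal (((N : ℝ) + 1)⁻¹ * ∑ i : Fin (N + 1),
          Set.indicator {v : V3 | max 1 (24 / (δ * κ ^ 4)) < ‖v‖} (fun v => ‖v‖ ^ 3)
            (((Φ N).flow s z i).2)) ∂(localGibbsLaw σ a₀ u₀ θ₀ N (Φ N))
      ≤ ∫⁻ z, ENNReal.ofReal δ * ENNReal.ofReal (((N : ℝ) + 1)⁻¹ * ∑ i : Fin (N + 1),
          Real.exp (κ * ‖((Φ N).flow s z i).2‖)) ∂(localGibbsLaw σ a₀ u₀ θ₀ N (Φ N)) :=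
        lintegral_mono (hpt ·)
    _ = ENNReal.ofReal δ * ∫⁻ z, ENNReal.ofReal (((N : ℝ) + 1)⁻¹ * ∑ i : Fin (N + 1),
          Real.exp (κ * ‖((Φ N).flow s z i).2‖)) ∂(localGibbsLaw σ a₀ u₀ θ₀ N (Φ N)) :=
        lintegral_const_mul' _ _ ENNReal.ofReal_ne_top
    _ ≤ ENNReal.ofReal δ * ENNReal.ofReal C := mul_le_mul' le_rfl (hb N hN s hsT)
    _ = ENNReal.ofReal (δ * C) := (ENNReal.ofReal_mul hδpos.le).symm
    _ ≤ ENNReal.ofReal ε := ENNReal.ofReal_le_ofReal hδC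

/-- **`ExpRateGivesCubicUI` holds** (support item stmt-AtomisticToContinuum-11520 of route ExpTailStaging): the
exponential velocity-moment rate K1 (stmt-11518) implies the shared cubic uniform-integrability item
`EnergyCurrentTails` (stmt-9235), by `energyCurrentTails_of_expVelocityMomentBound`. -/
theorem expTailStaging_expRateGivesCubicUI_proof : ExpRateGivesCubicUI :=
  fun h => energyCurrentTails_of_expVelocityMomentBound h

end Summit.AtomisticToContinuum.HydrodynamicLimit.Theorems

end
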